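import Mathlib.Analysis.SpecialFunctions.Pow.Real
import Mathlib.Analysis.SpecialFunctions.Sqrt
import Mathlib.LinearAlgebra.Eigenspace.Basic
import Literature.NumberTheory.EllipticCurves.HeckeOperators
import HarnessLib

/-!
# Deligne's bound (Ramanujan–Petersson) for the eigenvalues of `T_p` on `S_k(Γ₀(N))`, `p ∤ N`

Family `abc` (route `ABC/RibetTakahashiSplit`, item `LogFreeDegreeBound`, hypothesis H3), layer
`Literature/NumberTheory/EllipticCurves` next to the Hecke operators
`heckeT Γ k p = [Γ diag(1,p) Γ]` (`HeckeOperators.lean`, arithmetic normalisation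
`a_n(T_p f) = a_{pn}(f) + p^{k-1} a_{n/p}(f)`).

The NAMED FACT (D-0014) `Deligne1974_heckeT_eigenvalue_norm_le`: for `N ≥ 1`, `k ≥ 2` and a
prime `p ∤ N`, every eigenvalue `μ` of the Hecke operator `T_p` on the space `S_k(Γ₀(N))` of cusp
forms of weight `k` on `Γ₀(N)` satisfies `|μ| ≤ 2 p^{(k-1)/2}`. In print:

* P. Deligne, *La conjecture de Weil. I*, Publ. Math. IHÉS 43 (1974), **Théorème 8.2** (p. 302,
  read): for `N ≥ 1`, `ε : (ℤ/N)ˣ → ℂˣ`, `k ≥ 2` and `f = ∑ aₙ qⁿ` (`a₁ = 1`) a cuspidal PRIMITIVE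
  (new, in the sense of Atkin–Lehner and Miyake) form of weight `k` and character `ε` on `Γ₀(N)`,
  and `p` prime not dividing `N`: `|a_p| ≤ 2 p^{(k-1)/2}`; "en d'autres termes, les racines de
  l'équation `T² - a_p T + ε(p) p^{k-1}` sont de valeur absolue `p^{(k-1)/2}`" (Eichler–Shimura–
  Kuga–Ihara–Deligne: the roots are Frobenius eigenvalues on `H^{k-1}` of a smooth projective
  variety over `𝔽_p`, plus the Riemann hypothesis, Thm. 1.6 op. cit.).
* The passage from newforms to ALL eigenvalues of `T_p` on `S_k(Γ₀(N))` is Atkin–Lehner theory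
  (Atkin–Lehner 1970, Thm. 5: `S_k(Γ₀(N))` has the basis `{g(dτ) : g` a newform of level `M ∣ N`,
  `d ∣ N/M}`, and for `p ∤ N` each `g(dτ)` is a `T_p`-eigenvector with eigenvalue `a_p(g)`), and the
  resulting statement is the one printed in M. R. Murty, K. Sinha, *Effective equidistribution of
  eigenvalues of Hecke operators*, J. Number Theory 129 (2009), §1, p. 681 (read): "Let `S(N, k)`
  be the space of cusp forms of weight `k` on `Γ₀(N)` … By a result of Deligne [7], we know that
  the eigenvalues of `T_p` lie in the interval `[-2p^{(k-1)/2}, 2p^{(k-1)/2}]`" (`p` coprime to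
  `N`, as in their abstract).

We vendor the Murty–Sinha form restricted to the absolute value (the eigenvalues are moreover REAL,
`T_p` being self-adjoint for the Petersson product when `p ∤ N`; not vendored), for every weight
`k ≥ 2`, and PROVE the two shapes consumers use:

* `Deligne1974_heckeT_eigenvalue_norm_le.weight_two` — literally hypothesis H3 of
  `Summit.ABC.ABC.Theses.RibetTakahashiSplit.LogFreeDegreeBound`:
  `∀ N [NeZero N] ℓ [NeZero ℓ], ℓ.Prime → ¬ ℓ ∣ N → ∀ μ, HasEigenvalue (T_ℓ | S₂(Γ₀(N))) μ →
  ‖μ‖ ≤ 2 √ℓ`;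
* `Deligne1974_heckeT_eigenvalue_norm_le.norm_le_of_heckeT_eq_smul` — the eigenvector form
  (`T_p f = a • f`, `f ≠ 0` ⟹ `|a| ≤ 2 p^{(k-1)/2}`), which with the tree's
  `IsNewform0.heckeEigenvalue_eq_coeff` and `IsNewform0.ne_zero` gives back Deligne's `|a_p(f)|`
  bound for `Γ₀(N)`-newforms.

## Not vendored here

* Thm. 8.2 with nebentypus `ε` (forms on `Γ₁(N)`; carriers exist: `IsNewform1`, `nebentypus`) and
  the sharper "roots of `T² - a_p T + ε(p)p^{k-1}` have absolute value `p^{(k-1)/2}`";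
* realness of the eigenvalues / self-adjointness of `T_p` (`p ∤ N`);
* weight one (Deligne–Serre; the tree's `norm_cuspCoeff_le_card_divisors_weight_one`).

## References

* [Deligne1974] P. Deligne, La conjecture de Weil. I, Publ. Math. IHÉS 43 (1974), Thm. 8.2,
  Rem. 8.3.
* [MurtySinha2009] M. R. Murty, K. Sinha, J. Number Theory 129 (2009) 681–714, §1.
* [AtkinLehner1970] A. O. L. Atkin, J. Lehner, Hecke operators on `Γ₀(m)`, Math. Ann. 185 (1970),
  Thm. 3, Thm. 5.
-/

noncomputable section

open scoped MatrixGroups ModularForm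

open CongruenceSubgroup

namespace Literature.NumberTheory.EllipticCurves.ModularForms

/-- **Deligne's bound for the eigenvalues of `T_p` on `S_k(Γ₀(N))`** (named fact, D-0014). For
`N ≥ 1`, an integer weight `k ≥ 2` and a prime `p` not dividing `N`, every eigenvalue `μ ∈ ℂ` of the
Hecke operator `T_p = heckeT (Γ₀(N)) k p` on the cusp forms `S_k(Γ₀(N))` satisfies
`|μ| ≤ 2 · p^{(k-1)/2}` — Deligne's theorem `|a_p(f)| ≤ 2 p^{(k-1)/2}` for newforms (Weil I,
Thm. 8.2) transported to all of `S_k(Γ₀(N))` by the Atkin–Lehner decomposition into the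
`T_p`-eigenvectors `g(dτ)`, `g` a newform of level `M ∣ N` (Atkin–Lehner 1970, Thm. 5), as stated
in Murty–Sinha 2009, §1: "the eigenvalues of `T_p` lie in the interval
`[-2p^{(k-1)/2}, 2p^{(k-1)/2}]`". [cite: Deligne1974, Thm. 8.2 (p. 302)]
[cite: MurtySinha2009, §1 (p. 681)] [cite: AtkinLehner1970, Thm. 5] -/
def Deligne1974_heckeT_eigenvalue_norm_le : Prop :=
  ∀ (N : ℕ) [NeZero N] (k : ℤ), 2 ≤ k → ∀ (p : ℕ) [NeZero p], p.Prime → ¬ p ∣ N →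
    ∀ μ : ℂ, Module.End.HasEigenvalue (heckeT (Gamma0 N) k p) μ →
      ‖μ‖ ≤ 2 * (p : ℝ) ^ (((k : ℝ) - 1) / 2)

namespace Deligne1974_heckeT_eigenvalue_norm_le

/-- **Weight two** (hypothesis H3 of `RibetTakahashiSplit.LogFreeDegreeBound`, verbatim): granted
the named fact, every eigenvalue `μ` of `T_ℓ` on `S₂(Γ₀(N))`, `ℓ ∤ N` prime, has `|μ| ≤ 2√ℓ`
(`p^{(2-1)/2} = √p`). [cite: Deligne1974, Thm. 8.2] -/
theorem weight_two (h : Deligne1974_heckeT_eigenvalue_norm_le) :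
    ∀ (N : ℕ) [NeZero N] (ℓ : ℕ) [NeZero ℓ], ℓ.Prime → ¬ ℓ ∣ N → ∀ μ : ℂ,
      Module.End.HasEigenvalue (heckeT (Gamma0 N) 2 ℓ) μ → ‖μ‖ ≤ 2 * Real.sqrt ℓ := by
  intro N _ ℓ _ hℓ hℓN μ hμ
  have h2 := h N 2 le_rfl ℓ hℓ hℓN μ hμ
  rw [Real.sqrt_eq_rpow]
  convert h2 using 3
  norm_num

/-- **Eigenvector form**: granted the named fact, if `T_p f = a • f` for a NON-ZERO cusp form
`f ∈ S_k(Γ₀(N))` (`k ≥ 2`, `p ∤ N` prime), then `|a| ≤ 2 p^{(k-1)/2}`. With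
`IsNewform0.heckeEigenvalue_eq_coeff` and `IsNewform0.ne_zero` (tree) this is Deligne's bound
`|a_p(f)| ≤ 2 p^{(k-1)/2}` for `Γ₀(N)`-newforms. [cite: Deligne1974, Thm. 8.2] -/
theorem norm_le_of_heckeT_eq_smul (h : Deligne1974_heckeT_eigenvalue_norm_le) {N : ℕ} [NeZero N]
    {k : ℤ} (hk : 2 ≤ k) {p : ℕ} [NeZero p] (hp : p.Prime) (hpN : ¬ p ∣ N)
    {f : CuspForm (Gamma0 N) k} (hf : f ≠ 0) {a : ℂ} (ha : heckeT (Gamma0 N) k p f = a • f) :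
    ‖a‖ ≤ 2 * (p : ℝ) ^ (((k : ℝ) - 1) / 2) :=
  h N k hk p hp hpN a
    (Module.End.hasEigenvalue_of_hasEigenvector (Module.End.hasEigenvector_iff.2
      ⟨Module.End.mem_eigenspace_iff.2 ha, hf⟩))

/-- Monotone reformulation: granted the named fact, the spectral radius bound
`|μ| ≤ 2 p^{(k-1)/2} ≤ 2 p^{(k'-1)/2}` persists for any larger exponent `k' ≥ k` (`p ≥ 1`); recorded
for consumers who fix a uniform exponent. [folklore] -/
theorem norm_le_rpow_of_le (h : Deligne1974_heckeT_eigenvalue_norm_le) {N : ℕ} [NeZero N] {k : ℤ}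
    (hk : 2 ≤ k) {p : ℕ} [NeZero p] (hp : p.Prime) (hpN : ¬ p ∣ N) {μ : ℂ}
    (hμ : Module.End.HasEigenvalue (heckeT (Gamma0 N) k p) μ) {e : ℝ} (he : ((k : ℝ) - 1) / 2 ≤ e) :
    ‖μ‖ ≤ 2 * (p : ℝ) ^ e := by
  have h1 := h N k hk p hp hpN μ hμ
  have hp1 : (1 : ℝ) ≤ p := by exact_mod_cast hp.one_lt.le
  exact h1.trans (mul_le_mul_of_nonneg_left (Real.rpow_le_rpow_of_exponent_le hp1 he) (by norm_num))

end Deligne1974_heckeT_eigenvalue_norm_le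

end Literature.NumberTheory.EllipticCurves.ModularForms

end
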